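import Summits.Parity.BatemanHorn.Theorems.RoughValueTransportRoughValueLawLinearCells
import Summits.Parity.BatemanHorn.Theorems.RoughParitySectorsOddSectorShareLinearOneFormShare
import Summits.Parity.BatemanHorn.Theorems.RoughParitySectorsOddSectorShareNonlinearOddBuchstabMass
import Literature.NumberTheory.Sieve.RoughCellDensity
import Literature.NumberTheory.Sieve.BuchstabLimitFact
import HarnessLib

/-!
# Route `RoughParitySectors`, crux `OddSectorShareLinear` (stmt-Parity-15629), line `birth`:
# the registered stub `stub_integerShare` (Z: the integers' prime-within-odd share is `2e^γ/U`)

`--supports stmt-Parity-15629` file of the checked skeleton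
`Summits/Parity/BatemanHorn/Cruxes/OddSectorShareLinear/Lines/birth.lean`.  It PROVES the registered stub
`stub_integerShare` verbatim (= conjunct (ii) of the route's support item `LinearCalibration`,
stmt-Parity-15631): for every `η > 0` there is `U₀` such that for `U ≥ U₀`, eventually in `x`,
`|P_ℤ·(U e^{−γ}/2) − O_ℤ| ≤ η·O_ℤ`, where `P_ℤ = #{1 ≤ n ≤ x : n free of primes < ⌈x^{1/U}⌉₊, Ω(n) = 1}`
and `O_ℤ = #{… , Ω(n) odd}`.

Route: (a) for fixed `U > 2`, the integer cells are the `α = 1, β = 0` case of the linear cells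
(`OneFormShare.tendsto_card_filter_one`, `OneFormShare.tendsto_card_filter_odd`, i.e. Alladi's theorem via
`LinearCells.tendsto_card_filter_linear_cell`): `P_ℤ·log x/x → I_1(U) = 1` and
`O_ℤ·log x/x → T(U) := Σ_{i ≤ ⌈U⌉ even} I_{i+1}(U)`; since `I_j(U) = 0` for `j > U`
(`roughCellDensity_of_lt`), `T(U) = Σ_{j odd ≤ ⌊U⌋} I_j(U)` is the odd Buchstab mass
(`IntegerShare.sum_filter_even_succ_eq_oddMass`); (b) `T(U)/(U e^{−γ}/2) → 1`
(`OddSectorShareNonlinear.Birth.stub_oddBuchstabMass`: Buchstab's identity, the parity balance of the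
cell densities, `ω(U) → e^{−γ}`), hence `|U e^{−γ}/2 − T(U)| < η T(U)` for `U ≥ U₀`; (c) for such `U`,
`|P_ℤ·(U e^{−γ}/2) − O_ℤ|·(log x/x) → |U e^{−γ}/2 − T(U)| < η T(U) ← η·O_ℤ·(log x/x)`, and
`log x/x > 0` for `x ≥ 2`.  Everything used is PROVED in the tree; no definition and no new fact is
introduced.

References: K. Alladi, Quart. J. Math. Oxford (2) 33 (1982) 129–148 [Alladi1982]; Trans. AMS 272 (1982)
87–105 [Alladi1982Moebius]; H. L. Montgomery, R. C. Vaughan, *Multiplicative Number Theory I*, §7.2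
[MontgomeryVaughan2007]; G. Harman, *Prime-Detecting Sieves*, App. A.2 [Harman2007].
-/

noncomputable section

open Filter Finset Polynomial
open scoped BigOperators Topology ArithmeticFunction.Omega
open Literature.NumberTheory.Sieve

namespace Summit.Parity.BatemanHorn.Cruxes.OddSectorShareLinear.Birth

namespace IntegerShare

/-- Reindexing the odd cells: `Σ_{i < K, i even} f (i + 1) = Σ_{j < K + 1, j odd} f j`. [folklore] -/
theorem sum_filter_even_succ_eq (K : ℕ) (f : ℕ → ℝ) :
    ∑ i ∈ (range K).filter Even, f (i + 1) = ∑ j ∈ (range (K + 1)).filter Odd, f j := by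
  rw [sum_filter, sum_filter, sum_range_succ']
  simp only [Nat.odd_add_one, Nat.not_odd_iff_even, Nat.not_odd_zero, if_false, add_zero]

/-- Only the cells `j ≤ ⌊U⌋` carry mass: `I_j(U) = 0` for `j > U` (`roughCellDensity_of_lt`), so the odd
sum over `j < K` is the odd sum over `j ≤ ⌊U⌋` once `⌊U⌋ + 1 ≤ K`. [folklore] -/
theorem sum_filter_odd_eq_floor {U : ℝ} {K : ℕ} (hK : ⌊U⌋₊ + 1 ≤ K) :
    ∑ j ∈ (range K).filter Odd, roughCellDensity j U =
      ∑ j ∈ (range (⌊U⌋₊ + 1)).filter Odd, roughCellDensity j U := by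
  symm
  refine sum_subset (filter_subset_filter _ (range_subset_range.mpr hK)) fun j hj hj' => ?_
  have hjo := (mem_filter.mp hj).2
  have hge : ⌊U⌋₊ + 1 ≤ j := by
    by_contra h
    exact hj' (mem_filter.mpr ⟨mem_range.mpr (by omega), hjo⟩)
  refine roughCellDensity_of_lt j ?_
  calc U < (⌊U⌋₊ : ℝ) + 1 := Nat.lt_floor_add_one U
    _ = ((⌊U⌋₊ + 1 : ℕ) : ℝ) := by push_cast; ring
    _ ≤ j := by exact_mod_cast hge

/-- The limit `T(U) = Σ_{i ≤ ⌈U⌉ even} I_{i+1}(U)` of `OneFormShare.tendsto_card_filter_odd` is the odd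
Buchstab mass `Σ_{j odd ≤ ⌊U⌋} I_j(U)` of `OddSectorShareNonlinear.Birth.stub_oddBuchstabMass`.
[folklore] -/
theorem sum_filter_even_succ_eq_oddMass (U : ℝ) :
    ∑ i ∈ (range (⌈U⌉₊ + 1)).filter Even, roughCellDensity (i + 1) U =
      ∑ j ∈ (range (⌊U⌋₊ + 1)).filter Odd, roughCellDensity j U := by
  rw [sum_filter_even_succ_eq (⌈U⌉₊ + 1) (fun j => roughCellDensity j U)]
  exact sum_filter_odd_eq_floor (by have := Nat.floor_le_ceil U; omega)

/-- **Step (b)**, reciprocal form of `stub_oddBuchstabMass`: `(U e^{−γ}/2) / Σ_{j odd ≤ ⌊U⌋} I_j(U) → 1`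
as `U → ∞`. [folklore] -/
theorem tendsto_half_mul_div_oddMass :
    Tendsto (fun U : ℝ => (U * Real.exp (-Real.eulerMascheroniConstant) / 2) /
      ∑ j ∈ (range (⌊U⌋₊ + 1)).filter Odd, roughCellDensity j U) atTop (𝓝 1) := by
  have h := (OddSectorShareNonlinear.Birth.stub_oddBuchstabMass).inv₀ one_ne_zero
  rw [inv_one] at h
  exact h.congr fun U => by rw [inv_div]

end IntegerShare

/-- **Stub (Z): integer share** — registered stub `stub_integerShare` of crux stmt-Parity-15629 (line
`birth`), verbatim; = conjunct (ii) of support item `LinearCalibration` (stmt-Parity-15631): among the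
`x^{1/U}`-rough integers `≤ x` with odd `Ω`, the primes have the share `2e^γ/U·(1 + o(1))` as `U → ∞`
(Alladi's cells, Buchstab's identity, the parity balance of the cell densities, `ω(U) → e^{−γ}`).
[folklore] -/
theorem stub_integerShare :
    ∀ η : ℝ, 0 < η → ∃ U₀ : ℝ, ∀ U : ℝ, U₀ ≤ U → ∀ᶠ x : ℕ in Filter.atTop, |(((((Finset.Icc 1
    x).filter (fun n : ℕ => ∀ p ∈ Finset.range ⌈(x : ℝ) ^ (1 / U)⌉₊, p.Prime → ¬ (p ∣ n))).filter
    (fun n : ℕ => ArithmeticFunction.cardFactors n = 1)).card : ℕ) : ℝ) * (U * Real.exp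
    (-Real.eulerMascheroniConstant) / 2) - (((((Finset.Icc 1 x).filter (fun n : ℕ => ∀ p ∈
    Finset.range ⌈(x : ℝ) ^ (1 / U)⌉₊, p.Prime → ¬ (p ∣ n))).filter (fun n : ℕ => Odd
    (ArithmeticFunction.cardFactors n))).card : ℕ) : ℝ)| ≤ η * (((((Finset.Icc 1 x).filter (fun n :
    ℕ => ∀ p ∈ Finset.range ⌈(x : ℝ) ^ (1 / U)⌉₊, p.Prime → ¬ (p ∣ n))).filter (fun n : ℕ => Odd
    (ArithmeticFunction.cardFactors n))).card : ℕ) : ℝ) := by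
  intro η hη
  -- (b) choose `U₀`: `|A(U)/T(U) − 1| < η` for `U ≥ U₁`, `A(U) = U e^{−γ}/2`, `T` the odd Buchstab mass
  obtain ⟨U₁, hU₁⟩ := Metric.tendsto_atTop.mp IntegerShare.tendsto_half_mul_div_oddMass η hη
  refine ⟨max U₁ 3, fun U hU => ?_⟩
  have hU3 : (3 : ℝ) ≤ U := le_trans (le_max_right _ _) hU
  have hU2 : (2 : ℝ) < U := by linarith
  have hU1 : (1 : ℝ) ≤ U := by linarith
  have hd := hU₁ U (le_trans (le_max_left _ _) hU)
  rw [Real.dist_eq] at hd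
  set A : ℝ := U * Real.exp (-Real.eulerMascheroniConstant) / 2 with hA_def
  set T : ℝ := ∑ j ∈ (range (⌊U⌋₊ + 1)).filter Odd, roughCellDensity j U with hT_def
  -- `T ≥ I_1(U) = 1 > 0`, hence `|A − T| < η T`
  have hT1 : 1 ≤ T := by
    have hfl : 1 ≤ ⌊U⌋₊ := Nat.le_floor (by exact_mod_cast hU1)
    have h1 : (1 : ℕ) ∈ (range (⌊U⌋₊ + 1)).filter Odd :=
      mem_filter.mpr ⟨mem_range.mpr (by omega), odd_one⟩
    have h := single_le_sum (f := fun j => roughCellDensity j U)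
      (fun j _ => roughCellDensity_nonneg j U) h1
    rwa [roughCellDensity_one_of_one_le hU1] at h
  have hT0 : 0 < T := by linarith
  have hAT : |A - T| < η * T := by
    rw [div_sub_one hT0.ne', abs_div, abs_of_pos hT0, div_lt_iff₀ hT0] at hd
    exact hd
  -- names for the two counts
  obtain ⟨Pz, hPz⟩ : ∃ g : ℕ → ℝ, ∀ x : ℕ, g x = (#(((Icc 1 x).filter (fun n : ℕ =>
      ∀ p ∈ range ⌈(x : ℝ) ^ (1 / U)⌉₊, p.Prime → ¬ (p ∣ n))).filter
        (fun n : ℕ => Ω n = 1)) : ℝ) := ⟨_, fun _ => rfl⟩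
  obtain ⟨Oz, hOz⟩ : ∃ g : ℕ → ℝ, ∀ x : ℕ, g x = (#(((Icc 1 x).filter (fun n : ℕ =>
      ∀ p ∈ range ⌈(x : ℝ) ^ (1 / U)⌉₊, p.Prime → ¬ (p ∣ n))).filter
        (fun n : ℕ => Odd (Ω n))) : ℝ) := ⟨_, fun _ => rfl⟩
  -- (a) the two cell limits at fixed `U`: `Pz·log x/x → 1`, `Oz·log x/x → T`
  have hcop1 : (((0 : ℤ) % 1).toNat).Coprime (1 : ℤ).toNat := Nat.coprime_one_right _
  have e1 : ((1 : ℤ) : ℝ) / (((((1 : ℤ).toNat).totient : ℕ) : ℝ)) = 1 := by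
    rw [Int.toNat_one, Nat.totient_one, Nat.cast_one, Int.cast_one, div_one]
  have hPt : Tendsto (fun x => Pz x * Real.log x / x) atTop (𝓝 1) := by
    have h := OneFormShare.tendsto_card_filter_one (β := 0) one_pos hcop1 hU2
    rw [e1] at h
    refine h.congr fun x => ?_
    rw [hPz, OneFormShare.filter_filter_eq_linear_eq]
  have hOt : Tendsto (fun x => Oz x * Real.log x / x) atTop (𝓝 T) := by
    have h := OneFormShare.tendsto_card_filter_odd (β := 0) one_pos hcop1 hU2
    rw [e1, one_mul, IntegerShare.sum_filter_even_succ_eq_oddMass] at h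
    refine h.congr fun x => ?_
    rw [hOz, OneFormShare.filter_filter_eq_linear_odd]
  -- (c) assembly: `|Pz·A − Oz|·ℓ → |A − T| < η T ← η·Oz·ℓ`, `ℓ = log x/x > 0`
  have hF : Tendsto (fun x => |(Pz x * A - Oz x) * (Real.log x / x)|) atTop (𝓝 (|A - T|)) := by
    have h := ((hPt.mul_const A).sub hOt).abs
    rw [one_mul] at h
    refine h.congr fun x => ?_
    congr 1
    ring
  have hG : Tendsto (fun x => η * Oz x * (Real.log x / x)) atTop (𝓝 (η * T)) := by
    refine (hOt.const_mul η).congr fun x => ?_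
    ring
  filter_upwards [hF.eventually_lt hG hAT, eventually_gt_atTop 1] with x hx hx1
  have hx1R : (1 : ℝ) < x := by exact_mod_cast hx1
  have hlog : 0 < Real.log x := Real.log_pos hx1R
  have hx0 : (0 : ℝ) < x := by linarith
  have hw : 0 < Real.log x / x := by positivity
  rw [abs_mul, abs_of_pos hw] at hx
  have key := (lt_of_mul_lt_mul_right hx hw.le).le
  simpa only [hPz, hOz] using key

end Summit.Parity.BatemanHorn.Cruxes.OddSectorShareLinear.Birth

end
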